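import Literature.Combinatorics.SimpleGraph.LittleCoreDegrees
import Literature.Combinatorics.SimpleGraph.PfaffianIsomorphism
import Literature.Combinatorics.SimpleGraph.BicontractionNormalPosition
import Literature.Combinatorics.SimpleGraph.MatchingMinorCentral
import HarnessLib

/-!
# Minimal non-Pfaffian bipartite graphs with a digon are `K_{3,3}`

Topic `Combinatorics/SimpleGraph`; theorems only. The "digon case" of the finish of the hard
direction of Little's theorem (`Little1975_isPfaffianBipartite_iff_not_isMatchingMinor`,
`LittleTheorem.lean`), in the setting of `LittleTheoremReduction.lean` /
`LittleEarStructure.lean` / `LittleCoreDegrees.lean`: `G ⊆ Fin n × Fin n` contains the diagonal,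
is not Pfaffian, every `G.erase e` is Pfaffian, and every row has at least three entries (so
every vertex of `D(G, M)` has two out-arcs).

* `exists_doubleCycle_of_digon` — **if `D(G, M)` has a digon `u ⇄ v`, then `D(G, M)` is a double
  cycle**: there is a cyclic permutation `Y` moving every vertex, with `Y u = v`, such that
  `(a, b) ∈ G ↔ b = a ∨ b = Y a ∨ b = Y⁻¹ a`. Proof: in the ear structure `X, Y, S` of the
  (removable) arc `u → v` one of the two circuits, `X`, is the digon; every other vertex has its
  two out-arcs on `Y` and on `S`, so `Y` and `S` are Hamiltonian; the covering property for the
  return path obtained from `S` by any forward chord `x_i → Y x_i` shows that `Y` has no forward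
  chords, and a pigeonhole argument gives `Y x_i = x_{i-1}` along `S = (x_0, …, x_{n-1})`
  (Seymour–Thomassen 1987, (8): "`D` is a double-cycle").
* `isArc_symm_of_digon` — in particular `D(G, M)` is then symmetric.
* `isMatchingMinor_of_digon` — **hence `G` has a `K_{3,3}` matching minor** (indeed `n = 3` and
  `G = K_{3,3}`): for `n ≥ 4`, moving the reference matching to
  `{(u, Y⁻¹ u), (Y⁻¹ u, u)} ∪ diagonal` (a column relabelling, under which all hypotheses are
  invariant) produces a digraph with the digon `u ⇄ Y⁻¹ u` and the arc `u → v` but without the arc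
  `v → u`, contradicting `isArc_symm_of_digon` (this replaces Little's final parity count / the
  observation that odd double cycles on `≥ 5` pairs are not minimal).

## References

* C. H. C. Little, *A characterization of convertible (0,1)-matrices*, J. Combin. Theory Ser. B
  18 (1975) 187–208, §4. [Little1975]
* P. D. Seymour, C. Thomassen, *Characterization of even directed graphs*, J. Combin. Theory
  Ser. B 42 (1987) 36–45, §4 (7), (8). [SeymourThomassen1987]
* N. Robertson, P. D. Seymour, R. Thomas, *Permanents, Pfaffian orientations, and even directed
  circuits*, Ann. of Math. 150 (1999) 929–975, §7. [RobertsonSeymourThomas1999]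
-/

namespace Literature.Combinatorics.SimpleGraph

open Equiv Finset

variable {n : ℕ} {G : Finset (Fin n × Fin n)}

/-! ### Small facts -/

/-- A cyclic permutation exchanging `u` and `v` is the transposition. [folklore] -/
theorem eq_swap_of_apply_apply {X : Perm (Fin n)} (hX : X.IsCycle) {u v : Fin n} (huv : u ≠ v)
    (hXu : X u = v) (hXv : X v = u) : X = Equiv.swap u v := by
  have horbit : ∀ k : ℕ, (X ^ k) u = u ∨ (X ^ k) u = v := by
    intro k
    induction k with
    | zero => exact Or.inl rfl
    | succ k ih =>
      rw [pow_succ', Perm.mul_apply]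
      rcases ih with h | h
      · rw [h, hXu]; exact Or.inr rfl
      · rw [h, hXv]; exact Or.inl rfl
  refine Equiv.ext fun w => ?_
  by_cases hwu : w = u
  · subst hwu; rw [swap_apply_left, hXu]
  by_cases hwv : w = v
  · subst hwv; rw [swap_apply_right, hXv]
  rw [swap_apply_of_ne_of_ne hwu hwv]
  by_contra hw
  obtain ⟨k, hk⟩ := hX.exists_pow_eq (show X u ≠ u by rw [hXu]; exact huv.symm) hw
  rcases horbit k with h | h
  · exact hwu (hk.symm.trans h)
  · exact hwv (hk.symm.trans h)

/-- In the arc list of a list without repetitions, the first component determines the pair.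
[folklore] -/
theorem snd_eq_of_mem_zip_tail {α : Type*} {l : List α} (hl : l.Nodup) {a b b' : α}
    (h : (a, b) ∈ l.zip l.tail) (h' : (a, b') ∈ l.zip l.tail) : b = b' := by
  obtain ⟨i, hi, hip⟩ := List.getElem_of_mem h
  obtain ⟨i', hi', hip'⟩ := List.getElem_of_mem h'
  rw [List.getElem_zip] at hip hip'
  simp only [List.getElem_tail, Prod.mk.injEq, List.length_zip, List.length_tail] at hip hip' hi hi'
  have hii' : i = i' := hl.getElem_inj_iff.1 (hip.1.trans hip'.1.symm)
  subst hii'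
  exact hip.2.symm.trans hip'.2

/-- Consecutive elements of a list form an arc of it. [folklore] -/
theorem getElem_mem_zip_tail {α : Type*} (l : List α) {i : ℕ} (hi : i + 1 < l.length) :
    (l[i]'(Nat.lt_of_succ_lt hi), l[i + 1]) ∈ l.zip l.tail := by
  rw [List.mem_iff_getElem]
  refine ⟨i, by simp; omega, ?_⟩
  rw [List.getElem_zip]
  simp

/-- The first component of an arc of a list without repetitions is not its last element.
[folklore] -/
theorem fst_ne_getLast_of_mem_zip_tail {α : Type*} {l : List α} (hl : l.Nodup) (hne : l ≠ [])
    {p : α × α} (hp : p ∈ l.zip l.tail) : p.1 ≠ l.getLast hne := by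
  intro h
  obtain ⟨i, hi, hip⟩ := List.getElem_of_mem hp
  simp only [List.length_zip, List.length_tail] at hi
  have h1 : l[i]'(by omega) = l.getLast hne := by rw [← h, ← hip, List.getElem_zip]
  rw [List.getLast_eq_getElem] at h1
  have := hl.getElem_inj_iff.1 h1
  omega

/-- The arc following the vertex at position `i` of a list without repetitions. [folklore] -/
theorem eq_getElem_succ_of_mem_zip_tail {α : Type*} {l : List α} (hl : l.Nodup) {i : ℕ}
    (hi : i + 1 < l.length) {b : α} (h : (l[i]'(Nat.lt_of_succ_lt hi), b) ∈ l.zip l.tail) :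
    b = l[i + 1] :=
  snd_eq_of_mem_zip_tail hl h (getElem_mem_zip_tail l hi)

/-! ### The double cycle -/

/-- **A deletion-minimal non-Pfaffian `G ⊇ diagonal` with all out-degrees `≥ 2` whose digraph
has a digon `u ⇄ v` is a double cycle**: there is a cyclic permutation `Y` moving every vertex,
with `Y u = v`, such that `(a, b) ∈ G ↔ b = a ∨ b = Y a ∨ b = Y⁻¹ a`
(Seymour–Thomassen 1987, (8); Little 1975, §4). [cite: SeymourThomassen1987, §4 (8)] -/
theorem exists_doubleCycle_of_digon (hdiag : ∀ i, (i, i) ∈ G) (hG : ¬ IsPfaffianBipartite G)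
    (hdel : ∀ e ∈ G, IsPfaffianBipartite (G.erase e))
    (hout2 : ∀ x : Fin n, ∃ y₁ y₂, y₁ ≠ y₂ ∧ IsArc G x y₁ ∧ IsArc G x y₂) {u v : Fin n}
    (huv : IsArc G u v) (hvu : IsArc G v u) :
    ∃ Y : Perm (Fin n), Y.IsCycle ∧ (∀ a, Y a ≠ a) ∧ Y u = v ∧
      ∀ a b, (a, b) ∈ G ↔ b = a ∨ b = Y a ∨ b = Y.symm a := by
  classical
  -- strong connectivity, all arcs removable
  have hs : IsStrong G :=
    isStrong_of_deletionMinimal hdiag hG hdel fun x => let ⟨y, _, _, hy, _⟩ := hout2 x; ⟨y, hy⟩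
  have h₀ := exists_isArc_isStrong_erase hs u hout2
  have hrem : ∀ a b, IsArc G a b → IsStrong (G.erase (a, b)) := fun a b hab =>
    isStrong_erase_of_exists hdiag hG hdel hs hout2 h₀ hab
  -- ear structure of the arc `u → v`
  obtain ⟨s, A, B, lS, h1, -, hpos, hA, hAmem, hAu, hAw, hB, hBmem, hBu, hBw, hSchain, hSnd,
    hSlast, hcover, houtv, -, -, -⟩ :=
    exists_ear_structure_degrees hdiag hG hdel huv (hrem u v huv)
  -- the covering property for every return path
  have hcov : ∀ lS' : List (Fin n), (u :: lS').IsChain (IsArc (G.erase (u, v))) →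
      (u :: lS').getLast (List.cons_ne_nil _ _) = v →
      ∀ a b, IsArc G a b → A a = b ∨ B a = b ∨ (a, b) ∈ (u :: lS').zip lS' :=
    fun lS' hc hl => covering_of_triple hdiag hdel huv h1 hpos hA hAmem hAu hAw hB hBmem hBu hBw hc hl
  -- one of `A`, `B` is the digon; call it `X`, the other `Y`
  obtain ⟨X, Y, hX, hXmem, hXu, hXv, hY, hYmem, hYu, hcovXY⟩ : ∃ X Y : Perm (Fin n),
      X.IsCycle ∧ (∀ i, (i, X i) ∈ G) ∧ X u = v ∧ X v = u ∧
      Y.IsCycle ∧ (∀ i, (i, Y i) ∈ G) ∧ Y u = v ∧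
      ∀ lS' : List (Fin n), (u :: lS').IsChain (IsArc (G.erase (u, v))) →
        (u :: lS').getLast (List.cons_ne_nil _ _) = v →
        ∀ a b, IsArc G a b → X a = b ∨ Y a = b ∨ (a, b) ∈ (u :: lS').zip lS' := by
    rcases houtv u hvu with h | h
    · exact ⟨A, B, hA, hAmem, hAu, h.symm, hB, hBmem, hBu, hcov⟩
    · refine ⟨B, A, hB, hBmem, hBu, h.symm, hA, hAmem, hAu, fun lS' hc hl a b hab => ?_⟩
      rcases hcov lS' hc hl a b hab with h' | h' | h'
      exacts [Or.inr (Or.inl h'), Or.inl h', Or.inr (Or.inr h')]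
  clear hcover hcov houtv hAw hBw hpos h1 hA hAmem hAu hB hBmem hBu s A B
  have hXswap : X = swap u v := eq_swap_of_apply_apply hX huv.1 hXu hXv
  have hXfix : ∀ w, w ≠ u → w ≠ v → X w = w := fun w hwu hwv => by
    rw [hXswap, swap_apply_of_ne_of_ne hwu hwv]
  set L := u :: lS with hL
  have hLlen : L.length = lS.length + 1 := rfl
  have hLlen' : (u :: lS).length = lS.length + 1 := rfl
  have hLne : L ≠ [] := List.cons_ne_nil _ _
  have hcovL := hcovXY lS hSchain hSlast
  have hSchainG : L.IsChain (IsArc G) := isChain_isArc_mono hSchain (Finset.erase_subset _ _)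
  -- (1) every vertex other than `u`, `v` is moved by `Y` and lies on `S`, and its `S`-successor
  --     is not `Y w`
  have hlocal : ∀ w, w ≠ v → ∀ y, IsArc G w y → Y w = y ∨ (w, y) ∈ L.zip L.tail := by
    intro w hwv y hwy
    rcases hcovL w y hwy with h | h | h
    · -- `X w = y`: then `w ∈ {u, v}`; `w = u` gives `y = v = Y u`
      by_cases hwu : w = u
      · subst hwu; exact Or.inl (hYu.trans (hXu.symm.trans h))
      · exact absurd ((hXfix w hwu hwv).symm.trans h) hwy.1
    · exact Or.inl h
    · exact Or.inr h
  have hmoved : ∀ w, Y w ≠ w := by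
    intro w
    by_cases hwv : w = v
    · subst hwv
      intro h
      exact huv.1 (Y.injective (hYu.trans h.symm))
    obtain ⟨y₁, y₂, hne, hy₁, hy₂⟩ := hout2 w
    rcases hlocal w hwv y₁ hy₁ with h₁ | h₁
    · rw [h₁]; exact hy₁.1.symm
    rcases hlocal w hwv y₂ hy₂ with h₂ | h₂
    · rw [h₂]; exact hy₂.1.symm
    exact absurd (snd_eq_of_mem_zip_tail hSnd h₁ h₂) hne
  have hmemL : ∀ w, w ∈ L := by
    intro w
    by_cases hwv : w = v
    · subst hwv; rw [← hSlast]; exact List.getLast_mem hLne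
    obtain ⟨y₁, y₂, hne, hy₁, hy₂⟩ := hout2 w
    rcases hlocal w hwv y₁ hy₁ with h₁ | h₁
    · rcases hlocal w hwv y₂ hy₂ with h₂ | h₂
      · exact absurd (h₁.symm.trans h₂) hne
      · exact (List.of_mem_zip h₂).1
    · exact (List.of_mem_zip h₁).1
  have hlen : L.length = n := by
    have h1 : L.toFinset = Finset.univ := Finset.eq_univ_iff_forall.2 fun w =>
      List.mem_toFinset.2 (hmemL w)
    have h2 := List.toFinset_card_of_nodup hSnd
    rw [h1, Finset.card_univ, Fintype.card_fin] at h2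
    exact h2.symm
  have hsucc_ne : ∀ (i : ℕ) (hi : i + 1 < L.length), Y (L[i]'(Nat.lt_of_succ_lt hi)) ≠ L[i + 1] := by
    intro i hi heq
    have hiv : L[i]'(Nat.lt_of_succ_lt hi) ≠ v := by
      intro h
      rw [← hSlast, List.getLast_eq_getElem] at h
      have := hSnd.getElem_inj_iff.1 h
      omega
    obtain ⟨y₁, y₂, hne, hy₁, hy₂⟩ := hout2 (L[i]'(Nat.lt_of_succ_lt hi))
    have key : ∀ y, IsArc G (L[i]'(Nat.lt_of_succ_lt hi)) y → y = L[i + 1] := by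
      intro y hy
      rcases hlocal _ hiv y hy with h | h
      · exact h.symm.trans heq
      · exact eq_getElem_succ_of_mem_zip_tail hSnd hi h
    exact hne ((key y₁ hy₁).trans (key y₂ hy₂).symm)
  -- (2) no forward chords: `Y L[i] = L[j]` with `1 ≤ i` forces `j < i`
  have hchord : ∀ (i j : ℕ) (hi : i < L.length) (hj : j < L.length), 1 ≤ i →
      Y (L[i]) = L[j] → j < i := by
    intro i j hi hj hi1 hYij
    by_contra hji
    have hji' : i ≤ j := not_lt.1 hji
    have hjne : j ≠ i := by
      rintro rfl; exact hmoved _ hYij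
    have hjne1 : j ≠ i + 1 := by
      rintro rfl; exact hsucc_ne i hj hYij
    have hij2 : i + 2 ≤ j := by omega
    -- the return path with the chord `L[i] → L[j]`
    set L' := L.take (i + 1) ++ L.drop j with hL'
    have htake_ne : L.take (i + 1) ≠ [] := by simp [hLne]
    have hdrop_ne : L.drop j ≠ [] := by simp; omega
    have hL'eq : ∃ lS', L' = u :: lS' := by
      refine ⟨(L.take (i + 1)).tail ++ L.drop j, ?_⟩
      rw [hL']
      simp [hL, List.take_succ_cons]
    obtain ⟨lS', hlS'⟩ := hL'eq
    have hlast_take : (L.take (i + 1)).getLast htake_ne = L[i] := by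
      rw [List.getLast_eq_getElem]
      simp only [List.length_take, List.getElem_take]
      congr 1
      omega
    have hhead_drop : (L.drop j).head hdrop_ne = L[j] := by
      rw [List.head_drop]
    have hchain' : L'.IsChain (IsArc (G.erase (u, v))) := by
      rw [hL']
      refine List.IsChain.append (hSchain.take (i + 1)) (hSchain.drop j) fun x hx y hy => ?_
      rw [List.getLast?_eq_getLast_of_ne_nil htake_ne, Option.mem_def, Option.some_inj,
        hlast_take] at hx
      rw [List.head?_eq_some_head hdrop_ne, Option.mem_def, Option.some_inj, hhead_drop] at hy
      subst hx; subst hy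
      refine isArc_erase_iff.2 ⟨⟨fun h => hjne ?_, by rw [← hYij]; exact hYmem _⟩, fun h => ?_⟩
      · exact (hSnd.getElem_inj_iff.1 h).symm
      · have h0 : L[i] = u := (Prod.ext_iff.1 h).1
        have h00 : L[0] = u := rfl
        have := hSnd.getElem_inj_iff.1 (h0.trans h00.symm)
        omega
    have hlastq : L'.getLast? = some v := by
      rw [hL', List.getLast?_append, List.getLast?_eq_getLast_of_ne_nil hdrop_ne, List.getLast_drop,
        hSlast]
      rfl
    have hlastu : (u :: lS').getLast (List.cons_ne_nil _ _) = v := by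
      have h := hlastq
      rw [hlS', List.getLast?_eq_getLast_of_ne_nil (List.cons_ne_nil _ _), Option.some_inj] at h
      exact h
    have hchainu : (u :: lS').IsChain (IsArc (G.erase (u, v))) := by rw [← hlS']; exact hchain'
    have hcov' := hcovXY lS' hchainu hlastu
    -- the arc `L[i] → L[i+1]` is not covered
    have hi1' : i + 1 < L.length := by omega
    have harc : IsArc G L[i] L[i + 1] := List.isChain_iff_getElem.1 hSchainG i hi1'
    have hLiu : L[i] ≠ u := by
      intro h0
      have h00 : L[0] = u := rfl
      have := hSnd.getElem_inj_iff.1 (h0.trans h00.symm)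
      omega
    have hLiv : L[i] ≠ v := by
      intro h
      rw [← hSlast, List.getLast_eq_getElem] at h
      have := hSnd.getElem_inj_iff.1 h
      omega
    rcases hcov' _ _ harc with h | h | h
    · rw [hXfix _ hLiu hLiv] at h
      exact harc.1 h
    · exact hsucc_ne i hi1' h
    · -- an arc of `L'` starting at `L[i]` ends at `L[j]`
      have h' : (L[i], L[i + 1]) ∈ L'.zip L'.tail := by rw [hlS']; exact h
      have hnd' : L'.Nodup := by
        rw [hL']
        refine List.Nodup.append (hSnd.sublist (List.take_sublist _ _))
          (hSnd.sublist (List.drop_sublist _ _)) fun x hx1 hx2 => ?_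
        obtain ⟨k₁, hk₁, rfl⟩ := List.getElem_of_mem hx1
        obtain ⟨k₂, hk₂, hk⟩ := List.getElem_of_mem hx2
        simp only [List.length_take, List.getElem_take, List.length_drop, List.getElem_drop]
          at hk₁ hk₂ hk
        have := hSnd.getElem_inj_iff.1 hk
        omega
      -- position of `L[i]` in `L'` is `i`, and `L'[i+1] = L[j]`
      have hlen' : (L.take (i + 1)).length = i + 1 := by simp; omega
      have hi'lt : i + 1 < L'.length := by
        rw [hL', List.length_append, hlen', List.length_drop]; omega
      have hL'i : L'[i]'(Nat.lt_of_succ_lt hi'lt) = L[i] := by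
        simp only [hL']
        rw [List.getElem_append_left (by rw [hlen']; omega)]
        simp
      have hL'i1 : L'[i + 1]'hi'lt = L[j] := by
        simp only [hL']
        rw [List.getElem_append_right hlen'.le]
        simp [hlen']
      rw [← hL'i] at h'
      have h1 := eq_getElem_succ_of_mem_zip_tail hnd' hi'lt h'
      rw [hL'i1] at h1
      exact hjne1 (hSnd.getElem_inj_iff.1 h1).symm
  -- (3) pigeonhole: `Y L[i] = L[i-1]` for `1 ≤ i`
  have hindex : ∀ w, ∃ (j : ℕ) (hj : j < L.length), L[j] = w := fun w =>
    List.getElem_of_mem (hmemL w)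
  have hpred : ∀ (i : ℕ) (hi : i < L.length) (hi1 : 1 ≤ i),
      Y L[i] = L[i - 1]'(by omega) := by
    intro i
    induction i using Nat.strong_induction_on with
    | _ i ih =>
      intro hi hi1
      obtain ⟨j, hj, hjeq⟩ := hindex (Y L[i])
      have hji : j < i := hchord i j hi hj hi1 hjeq.symm
      by_cases hj1 : j = i - 1
      · subst hj1; exact hjeq.symm
      · exfalso
        have hj2 : j + 1 < i := by omega
        have h1 := ih (j + 1) hj2 (by omega) (by omega)
        simp only [Nat.add_sub_cancel] at h1
        -- `Y L[i] = L[j] = Y L[j+1]`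
        have h2 : L[i] = L[j + 1] := Y.injective (hjeq.symm.trans h1.symm)
        have := hSnd.getElem_inj_iff.1 h2
        omega
  -- (4) the double cycle
  refine ⟨Y, hY, hmoved, hYu, fun a b => ⟨fun hab => ?_, fun h => ?_⟩⟩
  · by_cases hab' : a = b
    · exact Or.inl hab'.symm
    rcases hcovL a b ⟨hab', hab⟩ with h | h | h
    · -- an arc of the digon
      by_cases hau : a = u
      · subst hau
        exact Or.inr (Or.inl (h.symm.trans (hXu.trans hYu.symm)))
      by_cases hav : a = v
      · subst hav
        refine Or.inr (Or.inr ?_)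
        rw [← h, hXv, Equiv.eq_symm_apply, hYu]
      · exact absurd ((hXfix a hau hav).symm.trans h) hab'
    · exact Or.inr (Or.inl h.symm)
    · -- an arc of `S`: `a = L[i]`, `b = L[i+1]`, and `Y b = a`
      obtain ⟨i, hi, hip⟩ := List.getElem_of_mem h
      have hi' : i + 1 < L.length := by
        have h' := hi
        simp only [List.length_zip] at h'
        omega
      rw [List.getElem_zip] at hip
      obtain ⟨ha, hb⟩ := Prod.ext_iff.1 hip
      simp only at ha hb
      refine Or.inr (Or.inr ?_)
      rw [Equiv.eq_symm_apply, ← ha, ← hb]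
      have := hpred (i + 1) hi' (by omega)
      have h2 : L[i + 1]'hi' = lS[i] := List.getElem_cons_succ ..
      rw [h2] at this
      simpa using this
  · rcases h with h | h | h
    · rw [h]; exact hdiag a
    · rw [h]; exact hYmem a
    · -- `(a, Y⁻¹ a) = (Y c, c)` for `c = Y⁻¹ a = L[i]`
      rw [h]
      obtain ⟨i, hi, hic⟩ := hindex (Y.symm a)
      have hYc : Y (L[i]) = a := by rw [hic, Equiv.apply_symm_apply]
      by_cases hi0 : i = 0
      · subst hi0
        have hcu : L[0] = u := rfl
        rw [hcu] at hic hYc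
        rw [← hic, ← hYc, hYu]
        exact hvu.2
      · have h1 := hpred i hi (by omega)
        rw [hYc] at h1
        -- the arc `L[i-1] → L[i]` of `S`
        have harc : IsArc G (L[i - 1]'(by omega)) (L[i]) := by
          have := List.isChain_iff_getElem.1 hSchainG (i - 1) (by omega)
          simp only [Nat.sub_add_cancel (Nat.one_le_iff_ne_zero.2 hi0)] at this
          exact this
        rw [← h1, hic] at harc
        exact harc.2

/-- **The digraph of a deletion-minimal non-Pfaffian `G ⊇ diagonal` with a digon is symmetric.**
[cite: SeymourThomassen1987, §4 (8)] -/
theorem isArc_symm_of_digon (hdiag : ∀ i, (i, i) ∈ G) (hG : ¬ IsPfaffianBipartite G)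
    (hdel : ∀ e ∈ G, IsPfaffianBipartite (G.erase e))
    (hout2 : ∀ x : Fin n, ∃ y₁ y₂, y₁ ≠ y₂ ∧ IsArc G x y₁ ∧ IsArc G x y₂) {u v : Fin n}
    (huv : IsArc G u v) (hvu : IsArc G v u) {a b : Fin n} (hab : IsArc G a b) : IsArc G b a := by
  obtain ⟨Y, -, -, -, hiff⟩ := exists_doubleCycle_of_digon hdiag hG hdel hout2 huv hvu
  refine ⟨hab.1.symm, ?_⟩
  rcases (hiff a b).1 hab.2 with h | h | h
  · exact absurd h.symm hab.1
  · exact (hiff b a).2 (Or.inr (Or.inr (by rw [h, Equiv.symm_apply_apply])))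
  · exact (hiff b a).2 (Or.inr (Or.inl (by rw [h, Equiv.apply_symm_apply])))

/-- **A deletion-minimal non-Pfaffian `G ⊇ diagonal` with all row degrees `≥ 3` whose digraph
has a digon has a `K_{3,3}` matching minor** — in fact it is `K_{3,3}`. By
`exists_doubleCycle_of_digon`, `D(G, M)` is a double cycle along a cyclic permutation `Y`; the
column relabelling exchanging `u` and `Y⁻¹ u` (i.e. the reference matching
`{(u, Y⁻¹ u), (Y⁻¹ u, u)} ∪ diagonal`) preserves all hypotheses and creates the digon
`u ⇄ Y⁻¹ u`, so the new digraph is symmetric (`isArc_symm_of_digon`); it contains the arc `u → Y u`,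
and the reverse arc forces `Y³ u = u`, i.e. `n = 3`, and then `G = K_{3,3}` (Little 1975, Thm 1;
Seymour–Thomassen 1987, Thm 4.1: the double cycle is odd, and by minimality has three pairs).
[cite: Little1975, Theorem 1] -/
theorem isMatchingMinor_of_digon (hdiag : ∀ i, (i, i) ∈ G) (hG : ¬ IsPfaffianBipartite G)
    (hdel : ∀ e ∈ G, IsPfaffianBipartite (G.erase e))
    (hrow : ∀ i, 3 ≤ (G.filter fun e : Fin n × Fin n => e.1 = i).card) {u v : Fin n}
    (huv : IsArc G u v) (hvu : IsArc G v u) :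
    IsMatchingMinor (Finset.univ : Finset (Fin 3 × Fin 3)) G := by
  classical
  have hout2 : ∀ x : Fin n, ∃ y₁ y₂, y₁ ≠ y₂ ∧ IsArc G x y₁ ∧ IsArc G x y₂ := fun x =>
    exists_two_isArc_of_three_le_card x (hdiag x) (hrow x)
  obtain ⟨Y, hY, hmoved, hYu, hiff⟩ := exists_doubleCycle_of_digon hdiag hG hdel hout2 huv hvu
  -- `n ≥ 3`
  have hn3 : 3 ≤ n := by
    obtain ⟨y₁, y₂, hne, hy₁, hy₂⟩ := hout2 u
    have h3 : ({u, y₁, y₂} : Finset (Fin n)).card = 3 := by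
      rw [Finset.card_eq_three]
      exact ⟨u, y₁, y₂, hy₁.1, hy₂.1, hne, rfl⟩
    calc 3 = ({u, y₁, y₂} : Finset (Fin n)).card := h3.symm
      _ ≤ (Finset.univ : Finset (Fin n)).card := Finset.card_le_univ _
      _ = n := by rw [Finset.card_univ, Fintype.card_fin]
  -- `Y` has order `n`
  have hsupp : Y.support = Finset.univ :=
    Finset.eq_univ_iff_forall.2 fun a => Perm.mem_support.2 (hmoved a)
  have hdvd : ∀ (a : Fin n) (k : ℕ), (Y ^ k) a = a → n ∣ k := by
    intro a k hk
    have h1 : Y ^ k = 1 := (hY.pow_eq_one_iff' (hmoved a)).2 hk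
    have h2 := orderOf_dvd_of_pow_eq_one h1
    rwa [hY.orderOf, hsupp, Finset.card_univ, Fintype.card_fin] at h2
  have hY2 : ∀ a, Y (Y a) ≠ a := by
    intro a h
    have := Nat.le_of_dvd (by norm_num) (hdvd a 2 (by simpa [pow_succ] using h))
    omega
  -- the switched reference matching: exchange the columns `u` and `w := Y⁻¹ u`
  set w := Y.symm u with hw
  have hYw : Y w = u := by simp [hw]
  have hwu : w ≠ u := fun h => hmoved w (hYw.trans h.symm)
  set κ : Perm (Fin n) := swap u w with hκ
  have hκu : κ u = w := by simp [hκ]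
  have hκw : κ w = u := by simp [hκ]
  have hκs : κ.symm = κ := by rw [hκ, Equiv.symm_swap]
  set G' := relabel G (Equiv.refl _) κ with hG'
  have hmem'' : ∀ x : Fin n × Fin n, x ∈ G' ↔ (x.1, κ x.2) ∈ G := fun x => by
    rw [hG', mem_relabel_iff, hκs]; rfl
  have hmem' : ∀ a b, (a, b) ∈ G' ↔ (a, κ b) ∈ G := fun a b => hmem'' (a, b)
  have hdiag' : ∀ i, (i, i) ∈ G' := by
    intro i
    rw [hmem']
    by_cases hiu : i = u
    · subst hiu; rw [hκu]; exact (hiff _ _).2 (Or.inr (Or.inr hw))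
    by_cases hiw : i = w
    · rw [hiw, hκw]; exact (hiff _ _).2 (Or.inr (Or.inl hYw.symm))
    · rw [show κ i = i from swap_apply_of_ne_of_ne hiu hiw]; exact hdiag i
  have hG'P : ¬ IsPfaffianBipartite G' := fun h =>
    hG ((isIsomorphic_relabel G (Equiv.refl _) κ).isPfaffianBipartite_iff.2 h)
  have hdel' : ∀ e ∈ G', IsPfaffianBipartite (G'.erase e) := by
    intro e he
    have he' : (e.1, κ e.2) ∈ G := (hmem' e.1 e.2).1 he
    have hmemE : ∀ x : Fin n × Fin n, x ∈ relabel (G.erase (e.1, κ e.2)) (Equiv.refl _) κ ↔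
        (x.1, κ x.2) ∈ G.erase (e.1, κ e.2) := fun x => by
      rw [mem_relabel_iff, hκs]; rfl
    have hinj : ∀ x y : Fin n × Fin n, (x.1, κ x.2) = (y.1, κ y.2) ↔ x = y := fun x y =>
      ⟨fun h => Prod.ext (Prod.ext_iff.1 h).1 (κ.injective (Prod.ext_iff.1 h).2),
        fun h => by rw [h]⟩
    have hrel : G'.erase e = relabel (G.erase (e.1, κ e.2)) (Equiv.refl _) κ := by
      ext x
      rw [Finset.mem_erase, hmem'' x, hmemE x, Finset.mem_erase, Ne, Ne, hinj]
    rw [hrel]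
    exact (isIsomorphic_relabel _ _ _).isPfaffianBipartite (hdel _ he')
  have hrow' : ∀ i, 3 ≤ (G'.filter fun e : Fin n × Fin n => e.1 = i).card := by
    intro i
    have h1 := card_filter_fst_relabel G (Equiv.refl _) κ i
    simp only [Equiv.refl_apply] at h1
    rw [hG', h1]
    exact hrow i
  have hout2' : ∀ x : Fin n, ∃ y₁ y₂, y₁ ≠ y₂ ∧ IsArc G' x y₁ ∧ IsArc G' x y₂ := fun x =>
    exists_two_isArc_of_three_le_card x (hdiag' x) (hrow' x)
  -- the digon `u ⇄ w` of the new digraph, and its symmetry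
  have huw' : IsArc G' u w := ⟨hwu.symm, (hmem' u w).2 (by rw [hκw]; exact hdiag u)⟩
  have hwu' : IsArc G' w u := ⟨hwu, (hmem' w u).2 (by rw [hκu]; exact hdiag w)⟩
  have hsym : ∀ a b, IsArc G' a b → IsArc G' b a := fun a b =>
    isArc_symm_of_digon hdiag' hG'P hdel' hout2' huw' hwu'
  -- the arc `u → v = Y u` of the new digraph is not reversible unless `n = 3`
  have hvw : v ≠ w := by
    intro h
    apply hY2 u
    rw [hYu, h, hYw]
  have huv' : IsArc G' u v :=
    ⟨huv.1, (hmem' u v).2 (by rw [show κ v = v from swap_apply_of_ne_of_ne huv.1.symm hvw]; exact huv.2)⟩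
  have hvu' := hsym u v huv'
  have hvw' : (v, w) ∈ G := by
    have := (hmem' v u).1 hvu'.2
    rwa [hκu] at this
  have hn : n = 3 := by
    rcases (hiff v w).1 hvw' with h | h | h
    · exact absurd h.symm hvw
    · -- `Y⁻¹ u = Y v = Y (Y u)`: `Y³ u = u`
      have h3 : (Y ^ 3) u = u := by
        have : Y (Y (Y u)) = u := by rw [hYu, ← h, hYw]
        simpa [pow_succ] using this
      have := Nat.le_of_dvd (by norm_num) (hdvd u 3 h3)
      omega
    · exact absurd (Y.symm.injective (hw.symm.trans h)) huv.1
  subst hn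
  -- `n = 3`: `G = K_{3,3}`
  have hGuniv : G = Finset.univ := by
    refine Finset.eq_univ_iff_forall.2 fun e => (hiff e.1 e.2).2 ?_
    have hcard : ({e.1, Y e.1, Y.symm e.1} : Finset (Fin 3)).card = 3 := by
      rw [Finset.card_eq_three]
      refine ⟨e.1, Y e.1, Y.symm e.1, (hmoved e.1).symm, fun h => hmoved e.1 ?_,
        fun h => hY2 e.1 ?_, rfl⟩
      · conv_lhs => rw [h]
        exact Equiv.apply_symm_apply _ _
      · rw [h, Equiv.apply_symm_apply]
    have huniv : ({e.1, Y e.1, Y.symm e.1} : Finset (Fin 3)) = Finset.univ :=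
      Finset.eq_univ_of_card _ (by rw [hcard, Fintype.card_fin])
    have hmem : e.2 ∈ ({e.1, Y e.1, Y.symm e.1} : Finset (Fin 3)) := by
      rw [huniv]; exact Finset.mem_univ _
    simp only [Finset.mem_insert, Finset.mem_singleton] at hmem
    exact hmem
  rw [hGuniv]
  exact IsMatchingMinor.refl _

/-- **The digon may be taken with respect to any perfect matching**: if `G ⊇ diagonal` is
deletion-minimal non-Pfaffian with all row degrees `≥ 3` and some perfect matching `σ` inside `G`
has an alternating 4-cycle (`i ≠ j` with `(i, σ j), (j, σ i) ∈ G`, i.e. a digon of `D(G, σ)`),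
then `G` has a `K_{3,3}` matching minor: move `σ` onto the diagonal by relabelling the columns
and apply `isMatchingMinor_of_digon`. [cite: Little1975, Theorem 1] -/
theorem isMatchingMinor_of_alternating_four_cycle
    (hG : ¬ IsPfaffianBipartite G) (hdel : ∀ e ∈ G, IsPfaffianBipartite (G.erase e))
    (hrow : ∀ i, 3 ≤ (G.filter fun e : Fin n × Fin n => e.1 = i).card)
    {σ : Perm (Fin n)} (hσ : ∀ i, (i, σ i) ∈ G) {i j : Fin n} (hij : i ≠ j)
    (hi : (i, σ j) ∈ G) (hj : (j, σ i) ∈ G) :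
    IsMatchingMinor (Finset.univ : Finset (Fin 3 × Fin 3)) G := by
  classical
  set G₂ := relabel G (Equiv.refl _) σ.symm with hG₂
  have hmem : ∀ x : Fin n × Fin n, x ∈ G₂ ↔ (x.1, σ x.2) ∈ G := fun x => by
    rw [hG₂, mem_relabel_iff, Equiv.symm_symm]; rfl
  have hdiag₂ : ∀ a, (a, a) ∈ G₂ := fun a => (hmem (a, a)).2 (hσ a)
  have hG₂P : ¬ IsPfaffianBipartite G₂ := fun h =>
    hG ((isIsomorphic_relabel G (Equiv.refl _) σ.symm).isPfaffianBipartite_iff.2 h)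
  have hdel₂ : ∀ e ∈ G₂, IsPfaffianBipartite (G₂.erase e) := by
    intro e he
    have he' : (e.1, σ e.2) ∈ G := (hmem e).1 he
    have hmemE : ∀ x : Fin n × Fin n, x ∈ relabel (G.erase (e.1, σ e.2)) (Equiv.refl _) σ.symm ↔
        (x.1, σ x.2) ∈ G.erase (e.1, σ e.2) := fun x => by
      rw [mem_relabel_iff, Equiv.symm_symm]; rfl
    have hinj : ∀ x y : Fin n × Fin n, (x.1, σ x.2) = (y.1, σ y.2) ↔ x = y := fun x y =>
      ⟨fun h => Prod.ext (Prod.ext_iff.1 h).1 (σ.injective (Prod.ext_iff.1 h).2),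
        fun h => by rw [h]⟩
    have hrel : G₂.erase e = relabel (G.erase (e.1, σ e.2)) (Equiv.refl _) σ.symm := by
      ext x
      rw [Finset.mem_erase, hmem x, hmemE x, Finset.mem_erase, Ne, Ne, hinj]
    rw [hrel]
    exact (isIsomorphic_relabel _ _ _).isPfaffianBipartite (hdel _ he')
  have hrow₂ : ∀ a, 3 ≤ (G₂.filter fun e : Fin n × Fin n => e.1 = a).card := by
    intro a
    have h1 := card_filter_fst_relabel G (Equiv.refl _) σ.symm a
    simp only [Equiv.refl_apply] at h1
    rw [hG₂, h1]
    exact hrow a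
  have hij₂ : IsArc G₂ i j := ⟨hij, (hmem (i, j)).2 hi⟩
  have hji₂ : IsArc G₂ j i := ⟨hij.symm, (hmem (j, i)).2 hj⟩
  exact (isMatchingMinor_of_digon hdiag₂ hG₂P hdel₂ hrow₂ hij₂ hji₂).of_relabel_host

end Literature.Combinatorics.SimpleGraph
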